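import Summits.KontsevichZagierPeriods.KontsevichZagierPeriods.Theses.HurwitzMicroSectors
import Summits.KontsevichZagierPeriods.KontsevichZagierPeriods.Theorems.HurwitzMicroSectorsNormalFormPrinciplePiBoxTransfer
import Summits.KontsevichZagierPeriods.KontsevichZagierPeriods.Theorems.HurwitzMicroSectorsNormalFormPrincipleVariants2320
import Summits.KontsevichZagierPeriods.KontsevichZagierPeriods.Theorems.HurwitzMicroSectorsNormalFormPrincipleVariants2295

/-! TTRL-lite variant V2296 of stmt-KontsevichZagierPeriods-3869

Variant V2296 = `stub_boxRigidity` (the leaf `BoxRigidity` of `NormalFormPrinciple`: two BOX-RATIONAL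
representations — domain the open unit box, integrand `p/q` over `ℚ`, `q ≠ 0` on the box — with equal
values are KZ-equivalent) under the move `fix_nat:m=5; bound_nat:m'≤6` (left dimension frozen to `5`,
right dimension `m' ≤ 6`). Verdict of the attempt seat: **open** — this file is the exact-strength
certificate, not a proof of the variant. Since `5 ≤ 6`, the tree's general fact
`boxRigidityFixBound_iff_boxVanishing_snd` (file `…Variants2320`: left dimension frozen to `K ≤ b`,
right bounded by `b`, is exactly BoxVanishing in dimension `b` — forward by comparing the zero
representation on `(0,1)⁵` with a vanishing box-rational `N' : IntegralRep 6`, backward by padding both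
to `(0,1)⁶` and subtracting) gives `V2296 ⟺ BoxVanishing 6` (every box-rational representation on
`(0,1)⁶` of value `0` is a relation; `stub_boxRigidity_var2296_iff_boxVanishing_six`), hence
`V2296 ⟺ BoxRigidity for all m, m' ≤ 6` (`…_iff_le_six`) and `V2296 ⟺ V2295` (`fix_nat:m=5; fix_nat:m'=6`,
`…_iff_var2295`): bounding `m' ≤ 6` instead of freezing `m' = 6` changes nothing. Why open: BoxVanishing 6
contains, for every `c : ℚ`, "`ζ(5) = c ⇒ [(0,1)⁵, 1/(1 − x₁⋯x₅) − c]` is a relation" and Catalan's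
dichotomy in dimension `2`; the side conditions of the four moves do not see values, so a proof must refute
`ζ(5) = c` (resp. `G = c`) for all but at most one explicit rational `c` — irrationality theorems nobody
has; the proved level is `m, m' ≤ 1` (`boxRigidity_of_le_one`, Baker). Conversely
`KontsevichZagierPeriods ⟹ parent ⟹ V2296` (`stub_boxRigidity_var2296_of_statement`), so `¬ V2296` would
refute the Summit (Conjecture 1 for the tree's calculus), and the tree has no invariant of `KZ.relations`
finer than `eval`. Residual goal: `BoxVanishing 6`.
Source: M. Kontsevich, D. Zagier, *Periods* (2001), §1.2 Conjecture 1. Pure proof file, no definitions. -/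

-- `Summit.<Summit>.<Problem>` is the tree's mandated summit-side namespace (CONVENTIONS §2); for this
-- single-conjunct summit the two coincide, so the duplicate is deliberate.
set_option linter.dupNamespace false

noncomputable section

namespace Summit.KontsevichZagierPeriods.KontsevichZagierPeriods.Theorems

open MeasureTheory Set
open Literature.NumberTheory.Transcendental Literature.NumberTheory.Transcendental.KZ
open Summit.KontsevichZagierPeriods.KontsevichZagierPeriods.Theses.HurwitzMicroSectors
open Summit.KontsevichZagierPeriods.HurwitzMicroSectors.NormalFormPrinciple.PiBox

/-! ## The variant V2296 is exactly `BoxVanishing 6` -/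

/-- **V2296 ⟺ `BoxVanishing 6`** (instance `K = 5 ≤ 6 = b` of `boxRigidityFixBound_iff_boxVanishing_snd`:
compare the zero representation on `(0,1)⁵` with a vanishing box-rational `N' : IntegralRep 6` one way;
pad to `(0,1)⁶` and subtract the other way). [cite: KontsevichZagier2001, §1.2 Conjecture 1] -/
theorem stub_boxRigidity_var2296_iff_boxVanishing_six :
    (∀ (m' : ℕ) (N : IntegralRep 5) (N' : IntegralRep m'), m' ≤ 6 → N.domain = {x | ∀ i, x i ∈ Set.Ioo (0:ℝ) 1} → N.IsRational → N'.domain = {x | ∀ i, x i ∈ Set.Ioo (0:ℝ) 1} → N'.IsRational → N.value = N'.value → Equivalent N N') ↔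
    (∀ (M : IntegralRep 6), M.domain = {x | ∀ i, x i ∈ Set.Ioo (0:ℝ) 1} → M.IsRational →
      M.value = 0 → of M ∈ relations) :=
  boxRigidityFixBound_iff_boxVanishing_snd (by norm_num)

/-- **V2296 ⟺ `BoxRigidity` for all `m, m' ≤ 6`** (the honest strength of the variant: Conjecture 1
for all pairs of rational integrands on the open unit boxes of dimension at most `6`; freezing `m := 5`
loses nothing against the bound `m' ≤ 6`, by padding). [cite: KontsevichZagier2001, §1.2 Conjecture 1] -/
theorem stub_boxRigidity_var2296_iff_le_six :
    (∀ (m' : ℕ) (N : IntegralRep 5) (N' : IntegralRep m'), m' ≤ 6 → N.domain = {x | ∀ i, x i ∈ Set.Ioo (0:ℝ) 1} → N.IsRational → N'.domain = {x | ∀ i, x i ∈ Set.Ioo (0:ℝ) 1} → N'.IsRational → N.value = N'.value → Equivalent N N') ↔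
    (∀ (m m' : ℕ) (N : IntegralRep m) (N' : IntegralRep m'), m' ≤ 6 → m ≤ 6 →
      N.domain = {x | ∀ i, x i ∈ Set.Ioo (0:ℝ) 1} → N.IsRational →
      N'.domain = {x | ∀ i, x i ∈ Set.Ioo (0:ℝ) 1} → N'.IsRational →
      N.value = N'.value → Equivalent N N') :=
  ⟨fun h => boxRigidityLe_of_boxVanishing (j := 6) (k := 6) le_rfl le_rfl
      (stub_boxRigidity_var2296_iff_boxVanishing_six.1 h),
    fun h m' N N' hm' => h 5 m' N N' hm' (by norm_num)⟩

/-- **V2296 ⟺ the sibling V2295** (`fix_nat:m=5; fix_nat:m'=6`): both are `BoxVanishing 6`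
(`stub_boxRigidity_var2295_iff_boxVanishing_six`, file `…Variants2295`) — bounding `m' ≤ 6` and
freezing `m' = 6` give the same statement. [cite: KontsevichZagier2001, §1.2 Conjecture 1] -/
theorem stub_boxRigidity_var2296_iff_var2295 :
    (∀ (m' : ℕ) (N : IntegralRep 5) (N' : IntegralRep m'), m' ≤ 6 → N.domain = {x | ∀ i, x i ∈ Set.Ioo (0:ℝ) 1} → N.IsRational → N'.domain = {x | ∀ i, x i ∈ Set.Ioo (0:ℝ) 1} → N'.IsRational → N.value = N'.value → Equivalent N N') ↔
    (∀ (N : IntegralRep 5) (N' : IntegralRep 6), N.domain = {x | ∀ i, x i ∈ Set.Ioo (0:ℝ) 1} → N.IsRational → N'.domain = {x | ∀ i, x i ∈ Set.Ioo (0:ℝ) 1} → N'.IsRational → N.value = N'.value → Equivalent N N') :=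
  stub_boxRigidity_var2296_iff_boxVanishing_six.trans stub_boxRigidity_var2295_iff_boxVanishing_six.symm

/-- **V2296 ⇒ `BoxVanishing` in every dimension `≤ 6`** (monotonicity by padding, `boxVanishing_mono`):
in particular the dimension-`5` statement containing the `ζ(5)` dichotomy and the dimension-`2`
statement containing Catalan's. [cite: KontsevichZagier2001, §1.2 Conjecture 1] -/
theorem boxVanishing_le_six_of_stub_boxRigidity_var2296
    (h : ∀ (m' : ℕ) (N : IntegralRep 5) (N' : IntegralRep m'), m' ≤ 6 → N.domain = {x | ∀ i, x i ∈ Set.Ioo (0:ℝ) 1} → N.IsRational → N'.domain = {x | ∀ i, x i ∈ Set.Ioo (0:ℝ) 1} → N'.IsRational → N.value = N'.value → Equivalent N N')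
    {j : ℕ} (hj : j ≤ 6) (N : IntegralRep j) (hNd : N.domain = {x | ∀ i, x i ∈ Set.Ioo (0:ℝ) 1})
    (hNr : N.IsRational) (hv : N.value = 0) : of N ∈ relations :=
  boxVanishing_mono hj (stub_boxRigidity_var2296_iff_boxVanishing_six.1 h) N hNd hNr hv

/-! ## Upper bounds: the parent leaf and the Summit imply V2296 -/

/-- **The parent leaf ⇒ V2296** (specialisation `m := 5`; the bound `m' ≤ 6` is simply dropped).
[cite: KontsevichZagier2001, §1.2 Conjecture 1] -/
theorem stub_boxRigidity_var2296_of_parent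
    (h : ∀ (m m' : ℕ) (N : IntegralRep m) (N' : IntegralRep m'), N.domain = {x | ∀ i, x i ∈ Set.Ioo (0:ℝ) 1} → N.IsRational → N'.domain = {x | ∀ i, x i ∈ Set.Ioo (0:ℝ) 1} → N'.IsRational → N.value = N'.value → Equivalent N N') :
    ∀ (m' : ℕ) (N : IntegralRep 5) (N' : IntegralRep m'), m' ≤ 6 → N.domain = {x | ∀ i, x i ∈ Set.Ioo (0:ℝ) 1} → N.IsRational → N'.domain = {x | ∀ i, x i ∈ Set.Ioo (0:ℝ) 1} → N'.IsRational → N.value = N'.value → Equivalent N N' :=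
  fun m' N N' _ => h 5 m' N N'

/-- **`KontsevichZagierPeriods ⇒ V2296`**: the variant is a special case of Conjecture 1 for the tree's
calculus (`leaves_of_statement`) — so a refutation of the variant would refute the Summit.
[cite: KontsevichZagier2001, §1.2 Conjecture 1] -/
theorem stub_boxRigidity_var2296_of_statement (h : _root_.KontsevichZagierPeriods) :
    ∀ (m' : ℕ) (N : IntegralRep 5) (N' : IntegralRep m'), m' ≤ 6 → N.domain = {x | ∀ i, x i ∈ Set.Ioo (0:ℝ) 1} → N.IsRational → N'.domain = {x | ∀ i, x i ∈ Set.Ioo (0:ℝ) 1} → N'.IsRational → N.value = N'.value → Equivalent N N' :=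
  stub_boxRigidity_var2296_of_parent (leaves_of_statement h).1

end Summit.KontsevichZagierPeriods.KontsevichZagierPeriods.Theorems

end
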